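import Summits.Parity.GeneralizedHardyLittlewood.Theses.FordMaynardSieveConst01651
import HarnessLib

/-!
# Line `closed_support_bridge` — target `SieveConst01651` (rank 0) of route `FordMaynardSieveConst01651`
(Parity / GeneralizedHardyLittlewood; item stmt-Parity-19185; line-writer seat `linewriter-parity-smallroutes-1` g0,
2026-08-31) — the SECOND VARIANT after the DIAGNOSIS of `cone_table_bridge` (see `Lines/closed_point.lean` under the cruxes
`FMThm73aLevelHalf` / `GCert01651`: the route's crux `GCert01651` is refutable and its bridge `FMThm73aLevelHalf` vacuous, both
because the transcription's support clause `∑ xᵢ < 1/2` is STRICT while the sign clause is imposed at the closed point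
`(1/2, 1/2)`).

LINE.  `SieveConst01651 = LowerSieveThresholdAt (1651/10000)` — unaffected by the defect — by the REPAIRED road:
  ⇐ `stub_coneCertClosed` (ccert, XL, research: `0.1651 <` printed `0.1663`): a `(𝟙⋆g)`-certificate on ORDERED-cone data `g₀`
    at `ν = 0.1651` with Ford–Maynard's CLOSED support `{∅} ∪ {all ξᵢ > ν, ∑ ξᵢ ≤ 1/2}` (⊆ `𝒢₁(P)`, (7.1) p. 27 with `ψ ≡ 0`),
    the sign condition `(𝟙⋆g₀)(x) ≤ 0` for every ORDERED `x` of dimension `2 ≤ k ≤ 6` with `ν < xᵢ < 1 − ν`, `∑ xᵢ = 1`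
    (this now includes boundary points such as `(1/2,1/2)`, forcing `g₀(1/2) ≤ −1/2`, and `(t, 1−t)`, forcing `g₀ ≤ −1` on
    `(ν, 1/2)`; the cell's LP table `spec_lp_01651_72.json` (kit j242906, `V = 0.0027065`) must be re-certified with the faces
    `|y| = 1/2` and the table's own cell faces included — degenerate polytope pieces are allowed by `IsConvexPolytope` and have
    measure zero, so `sieveBoundG1` is unchanged), and `0 < sieveBoundG1 0.1651 g₀`;
  + `stub_fm73aLevelHalfClosed` (print, XL): Ford–Maynard Theorem 7.3 (a) at `P = (1/2, 0, ν)`, `0 < ν < 1/4`, for symmetric `g`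
    piecewise constant on the ordered cone, with the CLOSED support clause — the repaired form of the tree's named fact
    `FordMaynard2024_thm73a_levelHalf` (which is vacuous as typed).  Implied by the printed theorem exactly as the tree's
    docstring argues (the closed `𝒢₁'` is still a subset of `𝒢₁`: for `|x| ≤ 1/2` with all `xᵢ > ν`, `(x, r/2, r/2) ∈ ℛ` with
    `r = 1 − |x|`, and `(1/2, 1/4, 1/4) = coag (1/4,1/4,1/4,1/4)`).  PRINT CAVEAT recorded for its future line: FM Lemma 7.18 (a)
    `H(n) = (𝟙⋆g)(𝐯(n))` holds for squarefree `n ∈ 𝒩` only; at this `P` the needed sign `H(n) ≤ 0` still holds for `n = p²m`,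
    `p > n^{1/4}` (coagulate the equal coordinates), and square factors `p² ≤ x^{1/2}` carry negligible mass by the trivial
    Type-I bound at modulus `p²` — a two-line patch, see `Lines/closed_point.md`.
  COMPOSITION (PROVED, kernel-checked): symmetrise `g₀` by `Tuple.sort` (`symmExt`, `starSum_perm` — copied from `cone_table_bridge`
  so that the file is self-contained), apply the repaired fact at `ν₀ = 0.1651` with `c = V/2`, and carry `c` to every
  `ν ∈ [0.1651, 1/3)` by `IsLowerSieveConst.mono` (Ford–Maynard Prop. 4.10, in the tree).
HONEST: standard road with corrected statements; the research content is entirely in `stub_coneCertClosed` (a certificate BEYOND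
print), the print content entirely in `stub_fm73aLevelHalfClosed`; line supply, kit 0.
-/

noncomputable section

open Finset
open Literature.NumberTheory.Sieve Literature.NumberTheory.Sieve.FordMaynard

namespace Summit.Parity.GeneralizedHardyLittlewood.Cruxes.SieveConst01651.ClosedSupportBridge

/-! ### Symmetric extension from the ordered cone -/

/-- The symmetric extension of cone data: `symmExt g₀ k x = g₀ k (x sorted increasingly)`. -/
def symmExt (g₀ : VecFn) : VecFn := fun k x => g₀ k (x ∘ ⇑(Tuple.sort x))

theorem symmExt_perm (g₀ : VecFn) (k : ℕ) (σ : Equiv.Perm (Fin k)) (x : Fin k → ℝ) :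
    symmExt g₀ k (x ∘ σ) = symmExt g₀ k x := by
  simp only [symmExt]
  rw [Tuple.comp_perm_comp_sort_eq_comp_sort]

/-- `symmExt g₀ ∈ 𝒮` (Definition 6.1). -/
theorem isSymmetric_symmExt (g₀ : VecFn) : (symmExt g₀).IsSymmetric :=
  fun k σ x => symmExt_perm g₀ k σ x

/-- On ordered vectors the extension is the data. -/
theorem symmExt_of_monotone (g₀ : VecFn) {k : ℕ} {x : Fin k → ℝ} (hx : Monotone x) :
    symmExt g₀ k x = g₀ k x := by
  simp only [symmExt]
  rw [Tuple.sort_eq_refl_iff_monotone.mpr hx]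
  simp

/-- On ordered vectors `starSum (symmExt g₀) = starSum g₀` (ordered subvectors of an ordered vector
are ordered). -/
theorem starSum_symmExt_of_monotone (g₀ : VecFn) {k : ℕ} {x : Fin k → ℝ} (hx : Monotone x) :
    starSum (symmExt g₀) k x = starSum g₀ k x := by
  unfold starSum
  refine Finset.sum_congr rfl fun A _ => ?_
  exact symmExt_of_monotone g₀ (hx.comp (A.orderEmbOfFin rfl).monotone)

/-- The sieve bound only reads ordered vectors: `sieveBoundG1 ν (symmExt g₀) = sieveBoundG1 ν g₀`. -/
theorem sieveBoundG1_symmExt (ν : ℝ) (g₀ : VecFn) :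
    sieveBoundG1 ν (symmExt g₀) = sieveBoundG1 ν g₀ := by
  unfold sieveBoundG1
  congr 1
  refine Finset.sum_congr rfl fun k _ => ?_
  congr 1
  funext x
  split_ifs with h
  · rw [starSum_symmExt_of_monotone g₀ h.2]
  · rfl

/-- `IsPiecewiseConstOnCone` only reads ordered vectors. -/
theorem isPiecewiseConstOnCone_symmExt {g₀ : VecFn} (h : IsPiecewiseConstOnCone g₀) :
    IsPiecewiseConstOnCone (symmExt g₀) := by
  intro k
  obtain ⟨m, P, c, hP, hg⟩ := h k
  exact ⟨m, P, c, hP, fun x hx => by rw [symmExt_of_monotone g₀ hx]; exact hg x hx⟩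

/-- The CLOSED support condition (`∑ xᵢ ≤ 1/2`, Ford–Maynard's `𝒢₁` at `P = (1/2,0,ν)`) transfers from ordered
vectors to all vectors. -/
theorem supportClosed_symmExt {ν : ℝ} {g₀ : VecFn}
    (h : ∀ (k : ℕ) (x : Fin k → ℝ), Monotone x → g₀ k x ≠ 0 →
      k = 0 ∨ ((∀ i, ν < x i) ∧ ∑ i, x i ≤ 1 / 2)) :
    ∀ (k : ℕ) (x : Fin k → ℝ), symmExt g₀ k x ≠ 0 →
      k = 0 ∨ ((∀ i, ν < x i) ∧ ∑ i, x i ≤ 1 / 2) := by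
  intro k x hne
  have hmono : Monotone (x ∘ ⇑(Tuple.sort x)) := Tuple.monotone_sort x
  rcases h k _ hmono hne with h0 | ⟨hall, hsum⟩
  · exact Or.inl h0
  · refine Or.inr ⟨fun i => ?_, ?_⟩
    · simpa using hall ((Tuple.sort x).symm i)
    · have : (∑ i, (x ∘ ⇑(Tuple.sort x)) i) = ∑ i, x i := by
        simp only [Function.comp_apply]
        exact Equiv.sum_comp (Tuple.sort x) x
      rwa [this] at hsum

/-! ### Permutation invariance of `starSum` for symmetric `g` -/

/-- Changing the proof of `B.card = n` / the index `n` along it does not change the `g`-value of the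
ordered listing of `x` on `B`. -/
theorem apply_orderEmb_cast (g : VecFn) {k : ℕ} (x : Fin k → ℝ) (B : Finset (Fin k)) {n : ℕ}
    (h : B.card = n) :
    g n (fun i => x (B.orderEmbOfFin h i)) = g B.card (fun i => x (B.orderEmbOfFin rfl i)) := by
  subst h; rfl

/-- For symmetric `g`, the `g`-value of `x` listed along ANY injective enumeration of a finite index
set `B` equals its value along the increasing enumeration. -/
theorem apply_comp_eq_of_range {g : VecFn} (hs : g.IsSymmetric) {k : ℕ} (x : Fin k → ℝ)
    (B : Finset (Fin k)) {n : ℕ} (hB : B.card = n) (f : Fin n → Fin k)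
    (hf : Function.Injective f) (hmem : ∀ i, f i ∈ B) :
    g n (x ∘ f) = g n (fun i => x (B.orderEmbOfFin hB i)) := by
  let π₀ : Fin n → Fin n := fun i => (B.orderIsoOfFin hB).symm ⟨f i, hmem i⟩
  have hπ₀ : Function.Injective π₀ := by
    intro i j hij
    have h1 := congrArg (fun t => ((B.orderIsoOfFin hB) t : Fin k)) hij
    simp only [π₀, OrderIso.apply_symm_apply] at h1
    exact hf h1
  let π : Equiv.Perm (Fin n) := Equiv.ofBijective π₀ (Finite.injective_iff_bijective.mp hπ₀)
  have hcomp : (fun i => x (B.orderEmbOfFin hB i)) ∘ ⇑π = x ∘ f := by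
    funext i
    simp only [Function.comp_apply, π, Equiv.ofBijective_apply, π₀]
    rw [← Finset.coe_orderIsoOfFin_apply, OrderIso.apply_symm_apply]
  rw [← hcomp, hs n π]

/-- **`(𝟙⋆g)` is permutation invariant for `g ∈ 𝒮`** (Definition 7.1 with Definition 6.1):
`starSum g k (x ∘ σ) = starSum g k x`. -/
theorem starSum_perm {g : VecFn} (hs : g.IsSymmetric) (k : ℕ) (σ : Equiv.Perm (Fin k))
    (x : Fin k → ℝ) : starSum g k (x ∘ σ) = starSum g k x := by
  unfold starSum
  rw [← Equiv.sum_comp (Equiv.finsetCongr σ)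
    (fun B : Finset (Fin k) => g B.card (fun i => x (B.orderEmbOfFin rfl i)))]
  refine Finset.sum_congr rfl fun A _ => ?_
  have hB : ((Equiv.finsetCongr σ) A).card = A.card := by
    simp only [Equiv.finsetCongr_apply, Finset.card_map]
  have hmem : ∀ i, (⇑σ ∘ ⇑(A.orderEmbOfFin rfl)) i ∈ (Equiv.finsetCongr σ) A := by
    intro i
    simp only [Function.comp_apply, Equiv.finsetCongr_apply, Finset.mem_map_equiv,
      Equiv.symm_apply_apply]
    exact A.orderEmbOfFin_mem rfl i
  have key := apply_comp_eq_of_range hs x ((Equiv.finsetCongr σ) A) hB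
    (⇑σ ∘ ⇑(A.orderEmbOfFin rfl)) (σ.injective.comp (A.orderEmbOfFin rfl).injective) hmem
  rw [apply_orderEmb_cast g x ((Equiv.finsetCongr σ) A) hB] at key
  exact key

/-! ### The `ℋ`-inequality: from ordered vectors in dimensions `2 … 6` to all vectors -/

/-- No vector of dimension `k ≥ 7` has all components `> 1651/10000` and sum `1`. -/
theorem dim_le_six {k : ℕ} {x : Fin k → ℝ} (hbox : ∀ i, (1651 / 10000 : ℝ) < x i)
    (hsum : ∑ i, x i = 1) : k ≤ 6 := by
  by_contra hk
  have hk7 : 7 ≤ k := by omega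
  have hlt : ∑ _i : Fin k, (1651 / 10000 : ℝ) < ∑ i, x i := by
    haveI : Nonempty (Fin k) := ⟨⟨0, by omega⟩⟩
    exact Finset.sum_lt_sum_of_nonempty Finset.univ_nonempty fun i _ => hbox i
  rw [Finset.sum_const, Finset.card_univ, Fintype.card_fin, nsmul_eq_mul, hsum] at hlt
  have : (7 : ℝ) ≤ k := by exact_mod_cast hk7
  nlinarith

/-- The `ℋ`-inequality for `symmExt g₀` at every `x`, from the inequality for `g₀` at ordered `x` in
dimensions `2 ≤ k ≤ 6`. -/
theorem starSum_nonpos_of_cone {g₀ : VecFn}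
    (hH : ∀ k : ℕ, 2 ≤ k → k ≤ 6 → ∀ x : Fin k → ℝ, Monotone x →
      (∀ i, (1651 / 10000 : ℝ) < x i ∧ x i < 1 - 1651 / 10000) → ∑ i, x i = 1 →
        starSum g₀ k x ≤ 0) :
    ∀ k : ℕ, 2 ≤ k → ∀ x : Fin k → ℝ,
      (∀ i, (1651 / 10000 : ℝ) < x i ∧ x i < 1 - 1651 / 10000) → ∑ i, x i = 1 →
        starSum (symmExt g₀) k x ≤ 0 := by
  intro k hk x hbox hsum
  have hk6 : k ≤ 6 := dim_le_six (fun i => (hbox i).1) hsum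
  rw [← starSum_perm (isSymmetric_symmExt g₀) k (Tuple.sort x) x,
    starSum_symmExt_of_monotone g₀ (Tuple.monotone_sort x)]
  refine hH k hk hk6 _ (Tuple.monotone_sort x) (fun i => hbox _) ?_
  have : (∑ i, (x ∘ ⇑(Tuple.sort x)) i) = ∑ i, x i := by
    simp only [Function.comp_apply]
    exact Equiv.sum_comp (Tuple.sort x) x
  rw [this, hsum]

/-! ### The stubs and the composition -/

/-- Stub statement 1: the certificate on CONE DATA at `ν = 1651/10000` with CLOSED support `∑ ξᵢ ≤ 1/2`. -/
def Signature.stub_coneCertClosed : Prop :=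
  ∃ g₀ : VecFn, IsPiecewiseConstOnCone g₀ ∧ (∀ e : Fin 0 → ℝ, g₀ 0 e = 1) ∧
    (∀ (k : ℕ) (x : Fin k → ℝ), Monotone x → g₀ k x ≠ 0 →
      k = 0 ∨ ((∀ i, (1651 / 10000 : ℝ) < x i) ∧ ∑ i, x i ≤ 1 / 2)) ∧
    (∀ k : ℕ, 2 ≤ k → k ≤ 6 → ∀ x : Fin k → ℝ, Monotone x →
      (∀ i, (1651 / 10000 : ℝ) < x i ∧ x i < 1 - 1651 / 10000) → ∑ i, x i = 1 →
        starSum g₀ k x ≤ 0) ∧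
    0 < sieveBoundG1 (1651 / 10000) g₀

/-- Stub statement 2: Ford–Maynard Theorem 7.3 (a) at `P = (1/2, 0, ν)`, `0 < ν < 1/4`, symmetric piecewise-constant `g`,
CLOSED support clause (the repaired `FordMaynard2024_thm73a_levelHalf`). -/
def Signature.stub_fm73aLevelHalfClosed : Prop :=
  ∀ ν : ℝ, 0 < ν → ν < 1 / 4 →
    ∀ g : VecFn, g.IsSymmetric → IsPiecewiseConstOnCone g →
      (∀ e : Fin 0 → ℝ, g 0 e = 1) →
      (∀ (k : ℕ) (x : Fin k → ℝ), g k x ≠ 0 → k = 0 ∨ ((∀ i, ν < x i) ∧ ∑ i, x i ≤ 1 / 2)) →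
      (∀ k : ℕ, 2 ≤ k → ∀ x : Fin k → ℝ, (∀ i, ν < x i ∧ x i < 1 - ν) → ∑ i, x i = 1 →
          starSum g k x ≤ 0) →
        ∀ c : ℝ, c < sieveBoundG1 ν g → IsLowerSieveConst (1 / 2) 0 ν c

/-- **Open stub 1** (XL, ccert, research — beyond the printed threshold `0.1663`): the closed-support cone-data certificate
at `ν = 0.1651`. -/
theorem stub_coneCertClosed :
    ∃ g₀ : VecFn, IsPiecewiseConstOnCone g₀ ∧ (∀ e : Fin 0 → ℝ, g₀ 0 e = 1) ∧
      (∀ (k : ℕ) (x : Fin k → ℝ), Monotone x → g₀ k x ≠ 0 →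
        k = 0 ∨ ((∀ i, (1651 / 10000 : ℝ) < x i) ∧ ∑ i, x i ≤ 1 / 2)) ∧
      (∀ k : ℕ, 2 ≤ k → k ≤ 6 → ∀ x : Fin k → ℝ, Monotone x →
        (∀ i, (1651 / 10000 : ℝ) < x i ∧ x i < 1 - 1651 / 10000) → ∑ i, x i = 1 →
          starSum g₀ k x ≤ 0) ∧
      0 < sieveBoundG1 (1651 / 10000) g₀ := by
  sorry

/-- **Open stub 2** (XL, print): Ford–Maynard Theorem 7.3 (a) (arXiv:2407.14368, Thm 7.3 (a) with (7.1), Def. 7.1–7.2,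
Lemma 8.4; proof §7 with §4–5, ~20 pp., unformalised) at `P = (1/2, 0, ν)` with the CLOSED support clause. -/
theorem stub_fm73aLevelHalfClosed :
    ∀ ν : ℝ, 0 < ν → ν < 1 / 4 →
      ∀ g : VecFn, g.IsSymmetric → IsPiecewiseConstOnCone g →
        (∀ e : Fin 0 → ℝ, g 0 e = 1) →
        (∀ (k : ℕ) (x : Fin k → ℝ), g k x ≠ 0 → k = 0 ∨ ((∀ i, ν < x i) ∧ ∑ i, x i ≤ 1 / 2)) →
        (∀ k : ℕ, 2 ≤ k → ∀ x : Fin k → ℝ, (∀ i, ν < x i ∧ x i < 1 - ν) → ∑ i, x i = 1 →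
            starSum g k x ≤ 0) →
          ∀ c : ℝ, c < sieveBoundG1 ν g → IsLowerSieveConst (1 / 2) 0 ν c := by
  sorry

example : Signature.stub_coneCertClosed := stub_coneCertClosed
example : Signature.stub_fm73aLevelHalfClosed := stub_fm73aLevelHalfClosed

/-- (added 2026-08-31T15:45Z) The print stub is LITERALLY the tree's repaired named fact
`Literature.NumberTheory.Sieve.FordMaynard.FordMaynard2024_thm73a_levelHalf_le` (landed p825368 after this seat's FINDING;
Ford–Maynard Theorem 7.3 (a) at `P = (1/2, 0, ν)` with the CLOSED support clause): kernel-checked by `Iff.rfl`. A route-level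
`closes` may therefore consume the fact as a hypothesis in place of this stub; the line `sieve_decomposition` is its deep cut
(a proof of the fact along FM §7.2 modulo narrower stubs). -/
example : Signature.stub_fm73aLevelHalfClosed ↔
    Literature.NumberTheory.Sieve.FordMaynard.FordMaynard2024_thm73a_levelHalf_le := Iff.rfl

/-- Non-vacuity witness for the repaired hypotheses (the point of the repair): the Legendre-type data
`g(∅) = 1`, `g(t) = −1` for `ν < t ≤ 1/2` in dimension one, `0` otherwise. -/
def legendreData : VecFn := fun k x =>
  if k = 0 then 1 else if k = 1 ∧ (∀ i, (1651 / 10000 : ℝ) < x i ∧ x i ≤ 1 / 2) then -1 else 0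

theorem legendreData_empty (e : Fin 0 → ℝ) : legendreData 0 e = 1 := by
  simp [legendreData]

theorem legendreData_support (k : ℕ) (x : Fin k → ℝ) (h : legendreData k x ≠ 0) :
    k = 0 ∨ ((∀ i, (1651 / 10000 : ℝ) < x i) ∧ ∑ i, x i ≤ 1 / 2) := by
  unfold legendreData at h
  by_cases hk : k = 0
  · exact Or.inl hk
  · rw [if_neg hk] at h
    by_cases hc : k = 1 ∧ ∀ i, (1651 / 10000 : ℝ) < x i ∧ x i ≤ 1 / 2
    · obtain ⟨rfl, hx⟩ := hc
      refine Or.inr ⟨fun i => (hx i).1, ?_⟩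
      rw [Fin.sum_univ_one]
      exact (hx 0).2
    · rw [if_neg hc] at h
      exact absurd rfl h

theorem legendreData_sign (k : ℕ) (hk : 2 ≤ k) (x : Fin k → ℝ)
    (hbox : ∀ i, (1651 / 10000 : ℝ) < x i ∧ x i < 1 - 1651 / 10000) (hsum : ∑ i, x i = 1) :
    starSum legendreData k x ≤ 0 := by
  classical
  unfold starSum
  -- pick an index `j` with `x j ≤ 1/2` (two coordinates `> 1/2` would already sum to more than `1`)
  obtain ⟨j, hj⟩ : ∃ j, x j ≤ 1 / 2 := by
    by_contra hcon
    push Not at hcon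
    have h01 : (⟨0, by omega⟩ : Fin k) ≠ ⟨1, by omega⟩ := by simp
    have hle : ∑ i ∈ ({⟨0, by omega⟩, ⟨1, by omega⟩} : Finset (Fin k)), x i ≤ ∑ i, x i :=
      Finset.sum_le_sum_of_subset_of_nonneg (Finset.subset_univ _) fun i _ _ => by linarith [(hbox i).1]
    rw [Finset.sum_pair h01, hsum] at hle
    linarith [hcon ⟨0, by omega⟩, hcon ⟨1, by omega⟩]
  -- every summand is `≤ 0` except the empty subvector (`= 1`), and the singleton `{j}` contributes `-1`
  have hterm : ∀ A : Finset (Fin k), A ≠ ∅ →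
      legendreData A.card (fun i => x (A.orderEmbOfFin rfl i)) ≤ 0 := by
    intro A hA
    unfold legendreData
    have hc : A.card ≠ 0 := fun h => hA (Finset.card_eq_zero.1 h)
    rw [if_neg hc]
    split_ifs <;> norm_num
  have hempty : legendreData (∅ : Finset (Fin k)).card (fun i => x ((∅ : Finset (Fin k)).orderEmbOfFin rfl i)) = 1 := by
    unfold legendreData
    rw [if_pos Finset.card_empty]
  have hsing : legendreData ({j} : Finset (Fin k)).card (fun i => x (({j} : Finset (Fin k)).orderEmbOfFin rfl i)) = -1 := by
    unfold legendreData
    have hc : ({j} : Finset (Fin k)).card ≠ 0 := by simp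
    rw [if_neg hc, if_pos]
    refine ⟨Finset.card_singleton j, fun i => ?_⟩
    have hmem : (({j} : Finset (Fin k)).orderEmbOfFin rfl i) ∈ ({j} : Finset (Fin k)) :=
      Finset.orderEmbOfFin_mem _ _ i
    rw [Finset.mem_singleton] at hmem
    dsimp only
    rw [hmem]; exact ⟨(hbox j).1, hj⟩
  have hne : (∅ : Finset (Fin k)) ≠ {j} := (Finset.singleton_ne_empty j).symm
  rw [← Finset.add_sum_erase _ _ (Finset.mem_univ (∅ : Finset (Fin k))),
    ← Finset.add_sum_erase _ _ (Finset.mem_erase.2 ⟨hne.symm, Finset.mem_univ _⟩), hempty, hsing]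
  have hrest : ∑ A ∈ ((Finset.univ : Finset (Finset (Fin k))).erase ∅).erase {j},
      legendreData A.card (fun i => x (A.orderEmbOfFin rfl i)) ≤ 0 :=
    Finset.sum_nonpos fun A hA => hterm A (Finset.mem_erase.1 (Finset.mem_erase.1 hA).2).1
  linarith

/-- **The three repaired clauses are jointly satisfiable** (contrast: with the tree's STRICT support clause they are
not — `Cruxes/FMThm73aLevelHalf/Lines/closed_point.lean`, theorem `starSum_const_half`). -/
theorem repairedClauses_satisfiable :
    ∃ g : VecFn, (∀ e : Fin 0 → ℝ, g 0 e = 1) ∧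
      (∀ (k : ℕ) (x : Fin k → ℝ), g k x ≠ 0 → k = 0 ∨ ((∀ i, (1651 / 10000 : ℝ) < x i) ∧ ∑ i, x i ≤ 1 / 2)) ∧
      (∀ k : ℕ, 2 ≤ k → ∀ x : Fin k → ℝ, (∀ i, (1651 / 10000 : ℝ) < x i ∧ x i < 1 - 1651 / 10000) →
        ∑ i, x i = 1 → starSum g k x ≤ 0) :=
  ⟨legendreData, legendreData_empty, legendreData_support, fun k hk x hbox hsum => legendreData_sign k hk x hbox hsum⟩

/-- **Composition (kernel-checked)**: the two repaired leaf stubs give the ROUTE TARGET BY NAME. -/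
theorem SieveConst01651_of :
    Signature.stub_coneCertClosed → Signature.stub_fm73aLevelHalfClosed →
      Summit.Parity.GeneralizedHardyLittlewood.Theses.FordMaynardSieveConst01651.SieveConst01651 := by
  intro h1 h2 ν hν _hν3
  obtain ⟨g₀, hpc, h0, hsupp, hH, hV⟩ := h1
  have hconst : IsLowerSieveConst (1 / 2) 0 (1651 / 10000) (sieveBoundG1 (1651 / 10000) g₀ / 2) := by
    have := h2 (1651 / 10000) (by norm_num) (by norm_num) (symmExt g₀) (isSymmetric_symmExt g₀)
      (isPiecewiseConstOnCone_symmExt hpc) (fun e => h0 _) (supportClosed_symmExt hsupp)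
      (starSum_nonpos_of_cone hH) (sieveBoundG1 (1651 / 10000) g₀ / 2)
      (by rw [sieveBoundG1_symmExt]; linarith)
    exact this
  exact ⟨_, by linarith, hconst.mono hν⟩

/-- **The skeleton instantiated**: the target BY NAME modulo the two registered stubs. -/
theorem SieveConst01651_of_stubs :
    Summit.Parity.GeneralizedHardyLittlewood.Theses.FordMaynardSieveConst01651.SieveConst01651 :=
  SieveConst01651_of stub_coneCertClosed stub_fm73aLevelHalfClosed

end Summit.Parity.GeneralizedHardyLittlewood.Cruxes.SieveConst01651.ClosedSupportBridge

end
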